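import Summits.ABC.IUTFork.Repair.RHOffSigmaToleranceExponentFar
import Summits.ABC.IUTFork.Repair.RHOffSigmaToleranceExponentDoor
import HarnessLib

/-!
# R-H ROUND 2, Q1 (rows 3/4/5; seat abc-iut-rh2-xi-1): the MULTIPLICATIVE abc-tolerance of the off-Σ remainder, VIII — THE EXPONENT CLASS, part 5
# (F° ∩ R19, the door): «Cor. 3.12 up to `B`» with a FIXED relative share (`B ≤ κ·T.gap + Tol`, licensed share `μ = 1 − κ`) at the genuine Θ-data
# of the SZPIRO-BAD RATIONAL `(P, l)` ALONE ⟹ abc WITH EXPONENT `1/μ` ON EVERY FAR-FROM-CUSPS FAMILY and `ABCWithExponent (3/μ)` on all triples —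
# R19's conclusion shape (a) at degree one: EXPLICIT 2, CONE-FREE, TRANSFER-FREE, window-free, `K_V`-free

PROOF-ONLY sequel (no `def`, no new `Prop`, no instance, no notation; nothing re-typed) of this seat's `RHOffSigmaToleranceExponentFar.lean` (part 4:
`abcExpOn_farFromCusps_of_dilatedDisplay_degOne` — dilated display `1/6 ↦ μ/6` at the rational points ⟹ `ABCWithExponentOn {FarFromCusps {2} ρ} (1/μ)`)
and `RHOffSigmaToleranceExponentDoor.lean` (p481644/p482577: `dilatedDisplay_degOne_of_offSigmaTolerance_szpiroBad` — [NUMΣ-upTo]₁-bad + [TOL-κ]₁-bad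
⟹ the dilated display at every admissible rational `(P, l)`, the hull estimate at `d_mod = 1` being the THEOREM
`ThetaPartIIDisplay.hullVolumeAtDatum_BIII_of_degree_le_one` and the Szpiro-good data carrying print's display by `Cor22.cor312AtDatum_of_szpiro`), in
abc-iut-rh-typ-7's EXP F1 currency (`GenEllThm21With.lean` p482093: `ABCWithExponentOn`, `ABCWithExponent`). Rung LADDER-ABC:A2.RESCUE.H, R-H round 2
EXPONENT PROGRAMME (EXP-SPEC v0.1: §2 F°, §6 R18 label cuts, §7 R19 conclusion of record = shape (a) «abc with exponent `1/μ₀` on every far-from-cusps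
family»). TAKES NO SIDE on [IUTchIII] Cor. 3.12 or on any author; typed ≠ proved; instantiated ≠ endorsed.

CONTENT (all at DEGREE ONE — hypotheses only at the genuine Θ-data of the Szpiro-bad admissible RATIONAL `(P, l)`; EXPLICIT 2 binders under abc-iut-c312-d1's
Szpiro-bad guard VERBATIM; no cone binder, no window, no `K_V`, no `K`-budget, no Belyi transfer, no `GenEll_thm21_primesWith`):
* `abcWithExponent_three_div_of_dilatedDisplay_degOne` — p481071's all-triples endpoint in F1's currency: `ABCWithExponent (3/μ)`;
* **`abcExpOn_farFromCusps_of_offSigmaTolerance_szpiroBad_degOne`** — [NUMΣ-upTo]₁-bad + `OffSigmaTolerance κ Tol(P,l) T B` (`0 ≤ κ < 1`) ⟹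
  `∀ ρ ∈ (0, 1/2], ABCWithExponentOn {P | P.FarFromCusps {2} ρ} (1/(1−κ))`; `abcWithExponent_of_offSigmaTolerance_szpiroBad_degOne` ⟹ `ABCWithExponent (3/(1−κ))`;
* **`abcExpOn_farFromCusps_share_of_offBound_degOne`** — THE READING'S CURRENCY: `B ≤ (1 − μ)·T.gap + Tol` (licensed share `μ ∈ (0,1]` of `M = T.gap`) ⟹
  `∀ ρ ∈ (0, 1/2], ABCWithExponentOn {P | P.FarFromCusps {2} ρ} (1/μ)` = R19's shape (a) with `Λ = 1/μ₀`; `abcWithExponent_three_div_share_of_offBound_degOne`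
  ⟹ `ABCWithExponent (3/μ)`.
COMPARISON WITH F5(a) (EXP-SPEC §0/§7, abc-iut-rh2-T-1 over F3/F4 + F4½): same conclusion shape and exponent; HERE the hypotheses are demanded ONLY at
rational `λ` (where [CONE-C] is dischargeable and is discharged) and the proof needs neither Cor. 2.2 (i)'s bounded-discrepancy classes nor the
`PartIIWith` port — the far-from-cusps condition enters through `ρ⁵·c³ ≤ (abc)_{odd}` only. READING (numbers, not adjectives): uniform label cut `κ = 1/2`
(R18 `μ₀ = 1/8`) ↦ exponent `8` on every far-from-cusps family, `24` on all triples; `1/μ₄ ≤ 3.26` (frey bed) ↦ `3.26` / `9.8`; HEX `1.49` ↦ `1.49` / `4.5`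
— IF those shares held at every height (no table says so; every tabulated datum is below Cor. 2.2 (ii)'s window). NOT here: a constant uniform in `ρ`
(= `ABCWithExponent (1/μ)`; R19). HONEST SCOPE: CONDITIONAL on the two labelled binders; nothing here asserts that abc (with any exponent, on any family)
is proved or refuted, or that Cor. 3.12 (weakened or not) holds at any datum; no side taken; typed ≠ proved; computed ≠ proved; instantiated ≠ endorsed.
[cite: Mochizuki2012, IUTchIV Thm. 1.10 pp. 22–31; Cor. 2.2 (ii) pp. 41–48] [cite: Mochizuki2012, IUTchIII Cor. 3.12 p. 173–174]
[cite: MochizukiGenEll2010, Ex 1.3 (ii) p.5; Thm 2.1 p.11–13] [claim: Mochizuki2012, status: disputed]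
Axioms: standard.
-/

noncomputable section

namespace Summit.ABC.IUTFork.Repair.RH.OffSigma

open Literature.IUT.LogVolume Literature.IUT.LogVolume.Cor22
open Literature.NumberTheory.DiophantineGeometry Literature.NumberTheory.DiophantineGeometry.GenEll
open Summit.ABC.ABC.Theorems
open NumberField IsDedekindDomain Real

/-! ## §1 All triples, F1 currency -/

/-- **`ABCWithExponent (3/μ)` from the DILATED display at the rational points** — p481071's `abc_exp_of_dilatedDisplay_degOne`
(`c < C_ε·rad^{3/μ+ε}`) in the EXP programme's currency (`Λ(1+ε) = 3/μ + 3ε/μ`). CONDITIONAL; nothing asserted; no side taken.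
[cite: Mochizuki2012, IUTchIV Cor. 2.2–2.3 pp. 41–55] [claim: Mochizuki2012, status: disputed] -/
theorem abcWithExponent_three_div_of_dilatedDisplay_degOne {μ : ℝ} (hμ0 : 0 < μ) (hμ1 : μ ≤ 1)
    (hdisp : ∀ η : ℝ, IsEtaPrm η → ∀ P : NFPoint, P ∈ UP → P.degree ≤ 1 → ∀ l : ℕ, l.Prime → 5 ≤ l →
      AdmitsCore P → CondP2 P l → CondP5 P l → CondP6 P l →
      1 / 6 * (μ * logQAvoid P {2, l}) ≤
        (1 + 20 * (dmod P : ℝ) / l) * (P.logDiff + logCondAvoid P {2, l})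
          + 20 * (2 ^ 12 * 3 ^ 3 * 5 * (dmod P : ℝ) * l + η)) :
    ABCWithExponent (3 / μ) := by
  intro ε hε
  have h3ε : 0 < 3 * ε / μ := by positivity
  obtain ⟨C, hC, h⟩ := abc_exp_of_dilatedDisplay_degOne hμ0 hμ1 hdisp h3ε
  refine ⟨C, hC, fun a b c ht => ?_⟩
  rw [show 3 / μ * (1 + ε) = 3 / μ + 3 * ε / μ by ring]
  exact h a b c ht

/-! ## §2 The door: share `κ` at the Szpiro-bad rational data ⟹ exponent `1/(1−κ)` on every far-from-cusps family -/

/-- **abc WITH EXPONENT `1/(1−κ)` ON EVERY FAR-FROM-CUSPS FAMILY FROM «COR. 3.12 UP TO `B`» UNDER A FIXED RELATIVE TOLERANCE `κ ∈ [0,1)` AT THE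
SZPIRO-BAD RATIONAL DATA** — [NUMΣ-upTo]₁-bad: `T.negAbsLogQ − B(P,l,T) ≤ T.negLogTheta` at every genuine Θ-volume datum of every Szpiro-bad admissible
RATIONAL `(P, l)`; [TOL-κ]₁-bad: `B ≤ κ·T.gap + ((l+1)/4)·5·d*·l` there (`OffSigmaTolerance κ Tol T B`) ⟹ for every `0 < ρ ≤ 1/2`,
`ABCWithExponentOn {P | P.FarFromCusps {2} ρ} (1/(1−κ))`: `∀ ε > 0, ∃ C = C(ρ, ε) > 0`, `c < C·rad(abc)^{(1+ε)/(1−κ)}` for all abc triples with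
`min(a, b) > ρ·c`, `2^{v₂(a)}, 2^{v₂(b)}, 2^{v₂(c)} ≤ ρ⁻¹`. EXPLICIT 2; cone-free (hull estimate at `d_mod = 1` a theorem), transfer-free (no Belyi map),
window-free, `K_V`-free. CONDITIONAL; nothing is asserted about the hypotheses; no side taken. [cite: Mochizuki2012, IUTchIV Cor. 2.2 (ii) pp. 41–48]
[cite: Mochizuki2012, IUTchIII Cor. 3.12 p. 173–174] [cite: MochizukiGenEll2010, Thm 2.1 p.12] [claim: Mochizuki2012, status: disputed] -/
theorem abcExpOn_farFromCusps_of_offSigmaTolerance_szpiroBad_degOne {κ : ℝ} (hκ0 : 0 ≤ κ) (hκ1 : κ < 1)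
    (B : ∀ (P : NFPoint) (l : ℕ), ThetaVolumeDatumAt P l → ℝ)
    (h312B₁ : ∀ P : NFPoint, P ∈ UP → P.degree ≤ 1 → ∀ l : ℕ, l.Prime → 5 ≤ l →
      AdmitsCore P → CondP2 P l → CondP5 P l → CondP6 P l →
      (((l : ℝ) + 5) / 4 < (dmod P : ℝ) ∨
        6 * l * (((l : ℝ) + 5) - 4 * dmod P) / (((l : ℝ) + 4) * ((l : ℝ) - 3))
            * (P.logDiff + (1 - 1 / (l : ℝ)) * logCondAvoid P {2, l})
          + 6 * l * ((l : ℝ) + 5) / (((l : ℝ) + 4) * ((l : ℝ) - 3)) * Real.log Real.pi < logQAvoid P {2, l}) →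
      ∀ T : ThetaVolumeDatumAt P l, T.negAbsLogQ - B P l T ≤ T.negLogTheta)
    (hTol₁ : ∀ P : NFPoint, P ∈ UP → P.degree ≤ 1 → ∀ l : ℕ, l.Prime → 5 ≤ l →
      AdmitsCore P → CondP2 P l → CondP5 P l → CondP6 P l →
      (((l : ℝ) + 5) / 4 < (dmod P : ℝ) ∨
        6 * l * (((l : ℝ) + 5) - 4 * dmod P) / (((l : ℝ) + 4) * ((l : ℝ) - 3))
            * (P.logDiff + (1 - 1 / (l : ℝ)) * logCondAvoid P {2, l})
          + 6 * l * ((l : ℝ) + 5) / (((l : ℝ) + 4) * ((l : ℝ) - 3)) * Real.log Real.pi < logQAvoid P {2, l}) →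
      ∀ T : ThetaVolumeDatumAt P l,
        OffSigmaTolerance κ (((l : ℝ) + 1) / 4 * (5 * ((((2 ^ 12 * 3 ^ 3 * 5 * dmod P : ℕ) : ℝ)) * l))) T (B P l T))
    {ρ : ℝ} (h0 : 0 < ρ) (h2 : ρ ≤ 1 / 2) :
    ABCWithExponentOn {P : NFPoint | P.FarFromCusps ({2} : Finset ℕ) ρ} (1 / (1 - κ)) :=
  abcExpOn_farFromCusps_of_dilatedDisplay_degOne (μ := 1 - κ) (by linarith) (by linarith)
    (dilatedDisplay_degOne_of_offSigmaTolerance_szpiroBad hκ0 B h312B₁ hTol₁) h0 h2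

/-- **The all-triples endpoint in F1's currency: `ABCWithExponent (3/(1−κ))`** under the same two binders (p481644's
`abc_exp_of_offSigmaTolerance_szpiroBad_degOne`, `c < C_ε·rad^{3/(1−κ)+ε}`). CONDITIONAL; no side taken. [cite: Mochizuki2012, IUTchIV Cor. 2.2–2.3 pp. 41–55]
[claim: Mochizuki2012, status: disputed] -/
theorem abcWithExponent_of_offSigmaTolerance_szpiroBad_degOne {κ : ℝ} (hκ0 : 0 ≤ κ) (hκ1 : κ < 1)
    (B : ∀ (P : NFPoint) (l : ℕ), ThetaVolumeDatumAt P l → ℝ)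
    (h312B₁ : ∀ P : NFPoint, P ∈ UP → P.degree ≤ 1 → ∀ l : ℕ, l.Prime → 5 ≤ l →
      AdmitsCore P → CondP2 P l → CondP5 P l → CondP6 P l →
      (((l : ℝ) + 5) / 4 < (dmod P : ℝ) ∨
        6 * l * (((l : ℝ) + 5) - 4 * dmod P) / (((l : ℝ) + 4) * ((l : ℝ) - 3))
            * (P.logDiff + (1 - 1 / (l : ℝ)) * logCondAvoid P {2, l})
          + 6 * l * ((l : ℝ) + 5) / (((l : ℝ) + 4) * ((l : ℝ) - 3)) * Real.log Real.pi < logQAvoid P {2, l}) →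
      ∀ T : ThetaVolumeDatumAt P l, T.negAbsLogQ - B P l T ≤ T.negLogTheta)
    (hTol₁ : ∀ P : NFPoint, P ∈ UP → P.degree ≤ 1 → ∀ l : ℕ, l.Prime → 5 ≤ l →
      AdmitsCore P → CondP2 P l → CondP5 P l → CondP6 P l →
      (((l : ℝ) + 5) / 4 < (dmod P : ℝ) ∨
        6 * l * (((l : ℝ) + 5) - 4 * dmod P) / (((l : ℝ) + 4) * ((l : ℝ) - 3))
            * (P.logDiff + (1 - 1 / (l : ℝ)) * logCondAvoid P {2, l})
          + 6 * l * ((l : ℝ) + 5) / (((l : ℝ) + 4) * ((l : ℝ) - 3)) * Real.log Real.pi < logQAvoid P {2, l}) →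
      ∀ T : ThetaVolumeDatumAt P l,
        OffSigmaTolerance κ (((l : ℝ) + 1) / 4 * (5 * ((((2 ^ 12 * 3 ^ 3 * 5 * dmod P : ℕ) : ℝ)) * l))) T (B P l T)) :
    ABCWithExponent (3 / (1 - κ)) :=
  abcWithExponent_three_div_of_dilatedDisplay_degOne (μ := 1 - κ) (by linarith) (by linarith)
    (dilatedDisplay_degOne_of_offSigmaTolerance_szpiroBad hκ0 B h312B₁ hTol₁)

/-! ## §3 The READING's currency: licensed share `μ` ⟹ exponent `1/μ` on every far-from-cusps family (R19 shape (a), `Λ = 1/μ₀`) -/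

/-- **R19's CONCLUSION SHAPE (a) AT DEGREE ONE, CONE-FREE: off-Σ bound `B ≤ (1 − μ)·T.gap + Tol(P,l)` (licensed share `μ ∈ (0,1]` of `M = T.gap`;
abc-iut-rh2-w-1 `RH.CellWeights` / abc-iut-rh2-T-1 `RH.SigmaMass`: `B_triv(Σᶜ) = (1 − μ_r)·M`) together with «Cor. 3.12 up to `B`» at the genuine Θ-data
of the Szpiro-bad admissible RATIONAL `(P, l)` ⟹ for every `0 < ρ ≤ 1/2`, `ABCWithExponentOn {P | P.FarFromCusps {2} ρ} (1/μ)`** — «exponent factor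
`1/μ_r`» of ROUND2/READING.md ON EVERY FAR-FROM-CUSPS FAMILY, with the hypotheses demanded only at rational `λ`. At the uniform label cut `κ = 1/2`
(EXP-SPEC R18: `μ₀ = 1/8`): exponent `8`. CONDITIONAL; nothing asserted; no side taken. [cite: Mochizuki2012, IUTchIV Cor. 2.2 (ii) pp. 41–48]
[cite: Mochizuki2012, IUTchIII Cor. 3.12 p. 173–174] [cite: MochizukiGenEll2010, Thm 2.1 p.12] [claim: Mochizuki2012, status: disputed] -/
theorem abcExpOn_farFromCusps_share_of_offBound_degOne {μ : ℝ} (hμ0 : 0 < μ) (hμ1 : μ ≤ 1)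
    (B : ∀ (P : NFPoint) (l : ℕ), ThetaVolumeDatumAt P l → ℝ)
    (h312B₁ : ∀ P : NFPoint, P ∈ UP → P.degree ≤ 1 → ∀ l : ℕ, l.Prime → 5 ≤ l →
      AdmitsCore P → CondP2 P l → CondP5 P l → CondP6 P l →
      (((l : ℝ) + 5) / 4 < (dmod P : ℝ) ∨
        6 * l * (((l : ℝ) + 5) - 4 * dmod P) / (((l : ℝ) + 4) * ((l : ℝ) - 3))
            * (P.logDiff + (1 - 1 / (l : ℝ)) * logCondAvoid P {2, l})
          + 6 * l * ((l : ℝ) + 5) / (((l : ℝ) + 4) * ((l : ℝ) - 3)) * Real.log Real.pi < logQAvoid P {2, l}) →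
      ∀ T : ThetaVolumeDatumAt P l, T.negAbsLogQ - B P l T ≤ T.negLogTheta)
    (hShare₁ : ∀ P : NFPoint, P ∈ UP → P.degree ≤ 1 → ∀ l : ℕ, l.Prime → 5 ≤ l →
      AdmitsCore P → CondP2 P l → CondP5 P l → CondP6 P l →
      (((l : ℝ) + 5) / 4 < (dmod P : ℝ) ∨
        6 * l * (((l : ℝ) + 5) - 4 * dmod P) / (((l : ℝ) + 4) * ((l : ℝ) - 3))
            * (P.logDiff + (1 - 1 / (l : ℝ)) * logCondAvoid P {2, l})
          + 6 * l * ((l : ℝ) + 5) / (((l : ℝ) + 4) * ((l : ℝ) - 3)) * Real.log Real.pi < logQAvoid P {2, l}) →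
      ∀ T : ThetaVolumeDatumAt P l,
        B P l T ≤ (1 - μ) * T.gap + ((l : ℝ) + 1) / 4 * (5 * ((((2 ^ 12 * 3 ^ 3 * 5 * dmod P : ℕ) : ℝ)) * l)))
    {ρ : ℝ} (h0 : 0 < ρ) (h2 : ρ ≤ 1 / 2) :
    ABCWithExponentOn {P : NFPoint | P.FarFromCusps ({2} : Finset ℕ) ρ} (1 / μ) := by
  rw [show 1 / μ = 1 / (1 - (1 - μ)) by rw [sub_sub_cancel]]
  exact abcExpOn_farFromCusps_of_offSigmaTolerance_szpiroBad_degOne (κ := 1 - μ) (by linarith) (by linarith) B h312B₁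
    (fun P hP hdeg l hl h5 hcore hP2 hP5 h6 hbad T => hShare₁ P hP hdeg l hl h5 hcore hP2 hP5 h6 hbad T) h0 h2

/-- **`ABCWithExponent (3/μ)` in the READING's currency** (all triples; one constant per `ε`, no `ρ`): the same two binders. CONDITIONAL; no side taken.
[cite: Mochizuki2012, IUTchIV Cor. 2.2–2.3 pp. 41–55] [claim: Mochizuki2012, status: disputed] -/
theorem abcWithExponent_three_div_share_of_offBound_degOne {μ : ℝ} (hμ0 : 0 < μ) (hμ1 : μ ≤ 1)
    (B : ∀ (P : NFPoint) (l : ℕ), ThetaVolumeDatumAt P l → ℝ)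
    (h312B₁ : ∀ P : NFPoint, P ∈ UP → P.degree ≤ 1 → ∀ l : ℕ, l.Prime → 5 ≤ l →
      AdmitsCore P → CondP2 P l → CondP5 P l → CondP6 P l →
      (((l : ℝ) + 5) / 4 < (dmod P : ℝ) ∨
        6 * l * (((l : ℝ) + 5) - 4 * dmod P) / (((l : ℝ) + 4) * ((l : ℝ) - 3))
            * (P.logDiff + (1 - 1 / (l : ℝ)) * logCondAvoid P {2, l})
          + 6 * l * ((l : ℝ) + 5) / (((l : ℝ) + 4) * ((l : ℝ) - 3)) * Real.log Real.pi < logQAvoid P {2, l}) →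
      ∀ T : ThetaVolumeDatumAt P l, T.negAbsLogQ - B P l T ≤ T.negLogTheta)
    (hShare₁ : ∀ P : NFPoint, P ∈ UP → P.degree ≤ 1 → ∀ l : ℕ, l.Prime → 5 ≤ l →
      AdmitsCore P → CondP2 P l → CondP5 P l → CondP6 P l →
      (((l : ℝ) + 5) / 4 < (dmod P : ℝ) ∨
        6 * l * (((l : ℝ) + 5) - 4 * dmod P) / (((l : ℝ) + 4) * ((l : ℝ) - 3))
            * (P.logDiff + (1 - 1 / (l : ℝ)) * logCondAvoid P {2, l})
          + 6 * l * ((l : ℝ) + 5) / (((l : ℝ) + 4) * ((l : ℝ) - 3)) * Real.log Real.pi < logQAvoid P {2, l}) →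
      ∀ T : ThetaVolumeDatumAt P l,
        B P l T ≤ (1 - μ) * T.gap + ((l : ℝ) + 1) / 4 * (5 * ((((2 ^ 12 * 3 ^ 3 * 5 * dmod P : ℕ) : ℝ)) * l))) :
    ABCWithExponent (3 / μ) := by
  rw [show 3 / μ = 3 / (1 - (1 - μ)) by rw [sub_sub_cancel]]
  exact abcWithExponent_of_offSigmaTolerance_szpiroBad_degOne (κ := 1 - μ) (by linarith) (by linarith) B h312B₁
    (fun P hP hdeg l hl h5 hcore hP2 hP5 h6 hbad T => hShare₁ P hP hdeg l hl h5 hcore hP2 hP5 h6 hbad T)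

end Summit.ABC.IUTFork.Repair.RH.OffSigma

end
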